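import Mathlib.Algebra.BigOperators.Intervals
import Mathlib.Algebra.Order.BigOperators.Group.Finset
import Mathlib.Algebra.Order.Chebyshev
import Mathlib.Tactic
import HarnessLib

/-!
# The Cohn–Elkies bound is not sharp in `ℝ³` (Li 2022) — kernel-evaluable certificate check

Third step towards discharging `Literature.Barriers.AtomisticToContinuum.Li2022_dualCertificate53`
(the computational content of Li 2022, Theorem 3). By `CohnElkiesNotSharp3DCertificate.lean`
(`exists_dualCertificate_of_even`) it suffices to exhibit an even integer function `β` on `ℤ₅₃³`
and to evaluate the two integers `certNu0 89 β`, `certTot 89 β` — sums over the `53³ = 148877`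
points of simple functions of the cyclic autoconvolution `β ∗ β`. This file makes that evaluation
feasible for the Lean KERNEL (no `native_decide`, no extra axioms), for any odd modulus
`N = 2H + 1`:

* `β = β⁺ - β⁻` is encoded by two natural-number tables `TP`, `TN` whose 64-bit slot `rank3 a b c`
  holds `β^±` on the orbit representative `0 ≤ a ≤ b ≤ c ≤ H` of the signed permutation group
  (`tdigit`, `entry`), read at `(|x₁|, |x₂|, |x₃|)` (`absBal`);
* the values of `β^±` on `[0,N)³` are packed, Kronecker style, into ONE natural number each
  (`cube`: slot `t₁ + L t₂ + L² t₃`, `L = 2N`, slot width `s` bits), by short structurally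
  recursive loops over the octant with mirrored placements (`rowLoop`, `planeLoop`, `cubeLoop`);
* the linear autoconvolutions are then three big-integer products (`cube TP * cube TP + …`,
  `2 * (cube TP * cube TN)`), evaluated by the kernel's GMP arithmetic, and the cyclic values are
  recovered by folds, windows and digit extraction with `%`, `/` by powers of two written as shifts
  (`lowSlots`, `dropSlots`, `foldAt`, `digitAt`; `Nat.pow` is avoided for large exponents);
* a scan over the octant (`rowScan`, `planeScan`, `cubeScan`, multiplicities `wt`) accumulates the
  correction mass and the positive mass (`digitStep`, classes `cls`: origin / shell
  `0 < |x|² < R` / other), and `check` compares `4³ N⁶ ν₀² Tn² < R³ tot² Td²`.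

The SEMANTICS is proved here in full (`compute_spec`): base-`2^s` digit sums (`pack`,
`pack_mod`, `pack_div`, `pack_digit`, `pack_window`, `pack_fold`), the cube as a box sum
(`cube_eq_sum_box`, mirror lemma `sum_range_mirror`), products of packed boxes as packed linear
convolutions (`conv3`, `sum_box_mul_sum_box`, `sum_box_eq_pack`), digit bounds by Cauchy–Schwarz
(`conv3_sq_le`; the check `8 · ∑β² < 2^s` makes all folded digits fit a slot), the three-level
extraction (`extract_cyc`) and the unrolled scans. The link to `ℤ_N³`, `autoconv`, `corrMass`,
`certNu0`, `certTot` and the soundness theorem `check_sound` are in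
`CohnElkiesNotSharp3DKernelSound.lean`; the data and the kernel evaluation for Li's `d = 3`,
`m = 53`, `r = √89` in the sequel. Measured cost of `compute 26 128 89 TP TN` in the kernel:
about 40 s.

All statements here are elementary arithmetic ([folklore]); the design (autoconvolution
certificates verified by exact integer arithmetic) replaces Li's interval-arithmetic verification
of `λ = Fμ ≥ 0` (Li 2022, §5 p. 9).
-/

open Finset
open scoped BigOperators

namespace Literature.Barriers.AtomisticToContinuum

namespace CEKernel

/-- Table digit `j` (64-bit slots). [folklore] -/
def tdigit (T j : ℕ) : ℕ := (T >>> (64 * j)) % 2 ^ 64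

/-- Colexicographic rank of the sorted triple `{a, b, c}`. [folklore] -/
def rank3 (a b c : ℕ) : ℕ :=
  let lo := min a (min b c)
  let hi := max a (max b c)
  let mid := a + b + c - lo - hi
  hi * (hi + 1) * (hi + 2) / 6 + mid * (mid + 1) / 2 + lo

/-- `|balanced representative|` of `t ∈ [0, 2H]`: `t` if `t ≤ H`, else `2H+1-t`. [folklore] -/
def absBal (H t : ℕ) : ℕ := if t ≤ H then t else 2 * H + 1 - t

/-- Table entry for the octant point `(a, b, c)`. [folklore] -/
def entry (T a b c : ℕ) : ℕ := tdigit T (rank3 a b c)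

section Build
variable (H s T : ℕ)

/-- Row accumulation: places the entries `a = H - k'`, `k' < k`, at the slots `a` and `2H+1-a`.
[folklore] -/
def rowLoop (b c : ℕ) : ℕ → ℕ → ℕ
  | 0, acc => acc
  | k + 1, acc =>
    rowLoop b c k (acc + (entry T (H - k) b c <<< (s * (H - k))) +
      (if H - k = 0 then 0 else entry T (H - k) b c <<< (s * (2 * H + 1 - (H - k)))))

/-- The packed row `(·, b, c)`: slot `t₁ < N` holds `entry (absBal t₁) b c`. [folklore] -/
def row (b c : ℕ) : ℕ := rowLoop H s T b c (H + 1) 0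

/-- Plane accumulation. [folklore] -/
def planeLoop (c : ℕ) : ℕ → ℕ → ℕ
  | 0, acc => acc
  | k + 1, acc =>
    planeLoop c k (acc + (row H s T (H - k) c <<< (s * (2 * (2 * H + 1)) * (H - k))) +
      (if H - k = 0 then 0 else
        row H s T (H - k) c <<< (s * (2 * (2 * H + 1)) * (2 * H + 1 - (H - k)))))

/-- The packed plane `(·, ·, c)`. [folklore] -/
def plane (c : ℕ) : ℕ := planeLoop H s T c (H + 1) 0

/-- Cube accumulation. [folklore] -/
def cubeLoop : ℕ → ℕ → ℕ
  | 0, acc => acc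
  | k + 1, acc =>
    cubeLoop k (acc + (plane H s T (H - k) <<< (s * (2 * (2 * H + 1)) ^ 2 * (H - k))) +
      (if H - k = 0 then 0 else
        plane H s T (H - k) <<< (s * (2 * (2 * H + 1)) ^ 2 * (2 * H + 1 - (H - k)))))

/-- The packed cube: slot `t₁ + L t₂ + L² t₃` holds `entry (absBal t₁) (absBal t₂) (absBal t₃)`.
[folklore] -/
def cube : ℕ := cubeLoop H s T (H + 1) 0

/-- Sum of squares of the table entries placed in the cube (for the digit bound). [folklore] -/
def ssRowLoop (b c : ℕ) : ℕ → ℕ → ℕ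
  | 0, acc => acc
  | k + 1, acc =>
    ssRowLoop b c k (acc + (if H - k = 0 then 1 else 2) * entry T (H - k) b c ^ 2)

/-- Sum-of-squares accumulation over the rows of a plane of the octant. [folklore] -/
def ssPlaneLoop (c : ℕ) : ℕ → ℕ → ℕ
  | 0, acc => acc
  | k + 1, acc =>
    ssPlaneLoop c k (acc + (if H - k = 0 then 1 else 2) * ssRowLoop H T (H - k) c (H + 1) 0)

/-- Sum-of-squares accumulation over the planes of the octant. [folklore] -/
def ssCubeLoop : ℕ → ℕ → ℕ
  | 0, acc => acc
  | k + 1, acc =>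
    ssCubeLoop k (acc + (if H - k = 0 then 1 else 2) * ssPlaneLoop H T (H - k) (H + 1) 0)

/-- `∑_{t ∈ [0,N)³} entry(absBal t)²`. [folklore] -/
def sumSq : ℕ := ssCubeLoop H T (H + 1) 0

end Build

/-- low `k` slots of `X`. [folklore] -/
def lowSlots (s X k : ℕ) : ℕ := X % (1 <<< (s * k))
/-- drop the low `k` slots of `X`. [folklore] -/
def dropSlots (s X k : ℕ) : ℕ := X >>> (s * k)
/-- fold at `k` slots. [folklore] -/
def foldAt (s X k : ℕ) : ℕ := lowSlots s X k + dropSlots s X k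

/-- Point class: `0` origin, `1` shell `0 < |x|² < R`, `2` otherwise. [folklore] -/
def cls (H R t₁ t₂ t₃ : ℕ) : ℕ :=
  let q := absBal H t₁ ^ 2 + absBal H t₂ ^ 2 + absBal H t₃ ^ 2
  if q = 0 then 0 else if q < R then 1 else 2

/-- Accumulators: correction mass and positive mass (the origin value is read separately). [folklore] -/
structure Acc where
  /-- `∑_{shell} |a| + ∑_{off shell, ≠ 0} a⁻` [folklore] -/
  corr : ℕ
  /-- `∑_{off shell, ≠ 0} a⁺` [folklore] -/
  pos : ℕ

/-- One point of the octant with multiplicity `w`: digits `a` (of `A`) and `b` (of `B`),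
value `a - b`, class `cl`. [folklore] -/
def digitStep (w a b cl : ℕ) (acc : Acc) : Acc :=
  if cl = 1 then { acc with corr := acc.corr + w * (if b ≤ a then a - b else b - a) }
  else if cl = 2 then
    (if b ≤ a then { acc with pos := acc.pos + w * (a - b) }
      else { acc with corr := acc.corr + w * (b - a) })
  else acc

/-- Multiplicity of the octant coordinate `t ∈ [0, H]`: `1` for `t = 0`, else `2`. [folklore] -/
def wt (t : ℕ) : ℕ := if t = 0 then 1 else 2

section Scan
variable (H s R : ℕ)

/-- Scan the digits `t₁ = H - k'`, `k' < k`, of a pair of folded rows. [folklore] -/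
def rowScan (rA rB t₂ t₃ : ℕ) : ℕ → Acc → Acc
  | 0, acc => acc
  | k + 1, acc =>
    rowScan rA rB t₂ t₃ k
      (digitStep (wt (H - k) * wt t₂ * wt t₃)
        (lowSlots s (dropSlots s rA (H - k)) 1) (lowSlots s (dropSlots s rB (H - k)) 1)
        (cls H R (H - k) t₂ t₃) acc)

/-- Scan the rows `t₂ ≤ H` of a folded plane. [folklore] -/
def planeScan (pA pB t₃ : ℕ) : ℕ → Acc → Acc
  | 0, acc => acc
  | k + 1, acc =>
    planeScan pA pB t₃ k
      (rowScan H s R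
        (foldAt s (lowSlots s (dropSlots s pA (2 * (2 * H + 1) * (H - k))) (2 * (2 * H + 1)))
          (2 * H + 1))
        (foldAt s (lowSlots s (dropSlots s pB (2 * (2 * H + 1) * (H - k))) (2 * (2 * H + 1)))
          (2 * H + 1))
        (H - k) t₃ (H + 1) acc)

/-- Scan the planes `t₃ ≤ H` of the folded cubes. [folklore] -/
def cubeScan (cA cB : ℕ) : ℕ → Acc → Acc
  | 0, acc => acc
  | k + 1, acc =>
    cubeScan cA cB k
      (planeScan H s R
        (foldAt s (lowSlots s (dropSlots s cA ((2 * (2 * H + 1)) ^ 2 * (H - k)))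
          ((2 * (2 * H + 1)) ^ 2)) ((2 * H + 1) * (2 * (2 * H + 1))))
        (foldAt s (lowSlots s (dropSlots s cB ((2 * (2 * H + 1)) ^ 2 * (H - k)))
          ((2 * (2 * H + 1)) ^ 2)) ((2 * H + 1) * (2 * (2 * H + 1))))
        (H - k) (H + 1) acc)

end Scan

/-- The cyclic digit `(t₁, t₂, t₃)` of a folded packed cube `X` (plane, row, slot extraction with
the folds at each level). [folklore] -/
def digitAt (H s X t₁ t₂ t₃ : ℕ) : ℕ :=
  lowSlots s (dropSlots s
    (foldAt s (lowSlots s (dropSlots s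
      (foldAt s (lowSlots s (dropSlots s X ((2 * (2 * H + 1)) ^ 2 * t₃)) ((2 * (2 * H + 1)) ^ 2))
        ((2 * H + 1) * (2 * (2 * H + 1))))
      (2 * (2 * H + 1) * t₂)) (2 * (2 * H + 1))) (2 * H + 1))
    t₁) 1

/-- The whole computation: returns `(sumSq, ν₀ = A(0) - B(0) digit pair, corr, pos)`. [folklore] -/
structure Result where
  ssq : ℕ
  a0 : ℕ
  b0 : ℕ
  corr : ℕ
  pos : ℕ

/-- **The whole kernel computation** on the tables `TP`, `TN`: sum of squares of the entries,
the origin digits of `A` and `B`, and the scanned correction and positive masses. [folklore] -/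
def compute (H s R TP TN : ℕ) : Result :=
  let L := 2 * (2 * H + 1)
  let cP := cube H s TP
  let cN := cube H s TN
  let A := foldAt s (cP * cP + cN * cN) ((2 * H + 1) * L ^ 2)
  let B := foldAt s (2 * (cP * cN)) ((2 * H + 1) * L ^ 2)
  let r := cubeScan H s R A B (H + 1) { corr := 0, pos := 0 }
  { ssq := sumSq H TP + sumSq H TN, a0 := digitAt H s A 0 0 0, b0 := digitAt H s B 0 0 0,
    corr := r.corr, pos := r.pos }

/-- The final Boolean certificate check for target `Tn/Td` in dimension 3. [folklore] -/
def check (H s R TP TN Tn Td : ℕ) : Bool :=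
  let r := compute H s R TP TN
  let N := 2 * H + 1
  let nu0 := r.a0 - r.b0 + r.corr
  let tot := nu0 + r.pos
  decide (8 * r.ssq < 2 ^ s ∧ r.b0 < r.a0 ∧ 0 < Td ∧
    4 ^ 3 * N ^ (2 * 3) * nu0 ^ 2 * Tn ^ 2 < R ^ 3 * tot ^ 2 * Td ^ 2)


/-! ## Packing semantics (base `2^s` digit sums) -/

section Pack

/-- `pack s K g = ∑_{i<K} g i · 2^{s i}`: the number whose base-`2^s` digits are `g 0, …, g (K-1)`
(when `g i < 2^s`). [folklore] -/
def pack (s K : ℕ) (g : ℕ → ℕ) : ℕ := ∑ i ∈ range K, g i * 2 ^ (s * i)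

variable {s : ℕ}

/-- `pack` of no slots. [folklore] -/
theorem pack_zero (g : ℕ → ℕ) : pack s 0 g = 0 := by simp [pack]

/-- `pack` of `K+1` slots. [folklore] -/
theorem pack_succ (K : ℕ) (g : ℕ → ℕ) : pack s (K + 1) g = pack s K g + g K * 2 ^ (s * K) := by
  simp [pack, sum_range_succ]

/-- `pack` of one slot. [folklore] -/
theorem pack_one (g : ℕ → ℕ) : pack s 1 g = g 0 := by simp [pack]

/-- `pack` depends only on the first `K` digits. [folklore] -/
theorem pack_congr {K : ℕ} {g g' : ℕ → ℕ} (h : ∀ i < K, g i = g' i) : pack s K g = pack s K g' :=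
  Finset.sum_congr rfl fun i hi ↦ by rw [h i (mem_range.mp hi)]

/-- `pack` is additive in the digits. [folklore] -/
theorem pack_add (K : ℕ) (g g' : ℕ → ℕ) :
    pack s K g + pack s K g' = pack s K (fun i ↦ g i + g' i) := by
  simp only [pack, ← sum_add_distrib, add_mul]

/-- `pack` is monotone in the digits. [folklore] -/
theorem pack_le_pack {K : ℕ} {g g' : ℕ → ℕ} (h : ∀ i < K, g i ≤ g' i) : pack s K g ≤ pack s K g' :=
  Finset.sum_le_sum fun i hi ↦ Nat.mul_le_mul_right _ (h i (mem_range.mp hi))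

/-- A `pack` of `K` digits below `2^s` is below `2^{sK}`. [folklore] -/
theorem pack_lt {K : ℕ} {g : ℕ → ℕ} (hg : ∀ i < K, g i < 2 ^ s) : pack s K g < 2 ^ (s * K) := by
  induction K with
  | zero => simp [pack]
  | succ K ih =>
    rw [pack_succ]
    have h1 : pack s K g < 2 ^ (s * K) := ih fun i hi ↦ hg i (by omega)
    have h2 : g K * 2 ^ (s * K) ≤ (2 ^ s - 1) * 2 ^ (s * K) :=
      Nat.mul_le_mul_right _ (Nat.le_sub_one_of_lt (hg K (by omega)))
    have h3 : 2 ^ (s * (K + 1)) = 2 ^ s * 2 ^ (s * K) := by rw [← pow_add]; ring_nf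
    have h4 : (2 ^ s - 1) * 2 ^ (s * K) + 2 ^ (s * K) = 2 ^ s * 2 ^ (s * K) := by
      rw [← Nat.succ_mul, Nat.sub_one, Nat.succ_pred_eq_of_pos (Nat.two_pow_pos s)]
    omega

/-- Splitting a `pack` at slot `k`. [folklore] -/
theorem pack_split (k n : ℕ) (g : ℕ → ℕ) :
    pack s (k + n) g = pack s k g + 2 ^ (s * k) * pack s n (fun i ↦ g (k + i)) := by
  simp only [pack, sum_range_add, mul_sum]
  congr 1
  refine Finset.sum_congr rfl fun i _ ↦ ?_
  rw [mul_add, pow_add]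
  ring

/-- The low `k` slots of a `pack` with digits below `2^s`. [folklore] -/
theorem pack_mod {k n : ℕ} {g : ℕ → ℕ} (hg : ∀ i < k, g i < 2 ^ s) :
    pack s (k + n) g % 2 ^ (s * k) = pack s k g := by
  rw [pack_split, Nat.add_mul_mod_self_left, Nat.mod_eq_of_lt (pack_lt hg)]

/-- Dropping the low `k` slots of a `pack` with digits below `2^s`. [folklore] -/
theorem pack_div {k n : ℕ} {g : ℕ → ℕ} (hg : ∀ i < k, g i < 2 ^ s) :
    pack s (k + n) g / 2 ^ (s * k) = pack s n (fun i ↦ g (k + i)) := by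
  rw [pack_split, Nat.add_mul_div_left _ _ (Nat.two_pow_pos _), Nat.div_eq_of_lt (pack_lt hg),
    zero_add]

/-- Digit extraction. [folklore] -/
theorem pack_digit {K k : ℕ} {g : ℕ → ℕ} (hg : ∀ i < K, g i < 2 ^ s) (hk : k < K) :
    pack s K g / 2 ^ (s * k) % 2 ^ s = g k := by
  obtain ⟨n, rfl⟩ : ∃ n, K = k + (1 + n) := ⟨K - k - 1, by omega⟩
  rw [pack_div (fun i hi ↦ hg i (by omega))]
  have : pack s (1 + n) (fun i ↦ g (k + i)) % 2 ^ (s * 1) = pack s 1 (fun i ↦ g (k + i)) :=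
    pack_mod (fun i hi ↦ hg (k + i) (by omega))
  rw [mul_one] at this
  rw [this, pack_one, add_zero]

/-- Window extraction: slots `[k, k+j)`. [folklore] -/
theorem pack_window {K k j : ℕ} {g : ℕ → ℕ} (hg : ∀ i < K, g i < 2 ^ s) (hk : k + j ≤ K) :
    pack s K g / 2 ^ (s * k) % 2 ^ (s * j) = pack s j (fun i ↦ g (k + i)) := by
  obtain ⟨n, rfl⟩ : ∃ n, K = k + (j + n) := ⟨K - k - j, by omega⟩
  rw [pack_div (fun i hi ↦ hg i (by omega))]
  exact pack_mod (fun i hi ↦ hg (k + i) (by omega))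

/-- Folding: low `k` slots plus the high part, for a number of at most `2k` slots. [folklore] -/
theorem pack_fold {k n : ℕ} {g : ℕ → ℕ} (hg : ∀ i < k + n, g i < 2 ^ s) (hn : n ≤ k) :
    pack s (k + n) g % 2 ^ (s * k) + pack s (k + n) g / 2 ^ (s * k) =
      pack s k (fun i ↦ g i + if i < n then g (k + i) else 0) := by
  rw [pack_mod (fun i hi ↦ hg i (by omega)), pack_div (fun i hi ↦ hg i (by omega)), ← pack_add]
  congr 1
  obtain ⟨m, rfl⟩ : ∃ m, k = n + m := ⟨k - n, by omega⟩
  rw [pack_split]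
  have : pack s m (fun i ↦ if n + i < n then g (n + m + (n + i)) else 0) = 0 := by
    unfold pack
    refine Finset.sum_eq_zero fun i _ ↦ ?_
    show (if n + i < n then g (n + m + (n + i)) else 0) * _ = 0
    rw [if_neg (by omega), zero_mul]
  rw [show pack s m (fun i ↦ (fun i ↦ if i < n then g (n + m + i) else 0) (n + i)) = 0 from this,
    mul_zero, add_zero]
  exact pack_congr fun i hi ↦ by rw [if_pos hi]

/-- `lowSlots` is reduction modulo `2^{sk}`. [folklore] -/
theorem lowSlots_eq (s X k : ℕ) : lowSlots s X k = X % 2 ^ (s * k) := by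
  rw [lowSlots, Nat.one_shiftLeft]

/-- `dropSlots` is division by `2^{sk}`. [folklore] -/
theorem dropSlots_eq (s X k : ℕ) : dropSlots s X k = X / 2 ^ (s * k) := by
  rw [dropSlots, Nat.shiftRight_eq_div_pow]

/-- `foldAt` in terms of `%` and `/`. [folklore] -/
theorem foldAt_eq (s X k : ℕ) : foldAt s X k = X % 2 ^ (s * k) + X / 2 ^ (s * k) := by
  rw [foldAt, lowSlots_eq, dropSlots_eq]

end Pack

/-! ## The cube as a triple sum -/

section Cube

/-- **Mirror lemma**: a sum over `t < 2H+1` of a quantity depending on `absBal H t` and `t`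
splits over the octant `a ≤ H` into the slot `a` and its mirror `2H+1-a`. [folklore] -/
theorem sum_range_mirror {M : Type*} [AddCommMonoid M] (H : ℕ) (F : ℕ → ℕ → M) :
    ∑ t ∈ range (2 * H + 1), F (absBal H t) t =
      ∑ a ∈ range (H + 1), (F a a + if a = 0 then 0 else F a (2 * H + 1 - a)) := by
  rw [sum_add_distrib]
  have hsplit : range (2 * H + 1) = range (H + 1) ∪ Ico (H + 1) (2 * H + 1) := by
    rw [range_eq_Ico, range_eq_Ico, Ico_union_Ico_eq_Ico (Nat.zero_le _) (by omega)]
  have hdisj : Disjoint (range (H + 1)) (Ico (H + 1) (2 * H + 1)) := by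
    rw [range_eq_Ico]; exact Ico_disjoint_Ico_consecutive _ _ _
  rw [hsplit, sum_union hdisj]
  congr 1
  · refine Finset.sum_congr rfl fun a ha ↦ ?_
    rw [absBal, if_pos (by simpa using ha)]
  · -- reflect the upper half
    rw [sum_Ico_eq_sum_range]
    rw [show 2 * H + 1 - (H + 1) = H by omega]
    rw [sum_range_succ', if_pos rfl, add_zero]
    rw [← sum_range_reflect]
    refine Finset.sum_congr rfl fun j hj ↦ ?_
    rw [mem_range] at hj
    rw [if_neg (by omega), absBal, if_neg (by omega)]
    congr 1 <;> omega

/-- The mirror lemma in loop order (`j ↦ a = H - j`). [folklore] -/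
theorem sum_loop_mirror {M : Type*} [AddCommMonoid M] (H : ℕ) (F : ℕ → ℕ → M) :
    ∑ j ∈ range (H + 1), (F (H - j) (H - j) + if H - j = 0 then 0 else F (H - j) (2 * H + 1 - (H - j))) =
      ∑ t ∈ range (2 * H + 1), F (absBal H t) t := by
  rw [sum_range_mirror]
  conv_rhs => rw [← sum_range_reflect]
  refine Finset.sum_congr rfl fun j hj ↦ ?_
  rw [mem_range] at hj
  rw [show H + 1 - 1 - j = H - j by omega]

variable (H s T : ℕ)

/-- Unrolling the row loop. [folklore] -/
theorem rowLoop_eq (b c k acc : ℕ) : rowLoop H s T b c k acc = acc +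
    ∑ j ∈ range k, (entry T (H - j) b c * 2 ^ (s * (H - j)) +
      if H - j = 0 then 0 else entry T (H - j) b c * 2 ^ (s * (2 * H + 1 - (H - j)))) := by
  induction k generalizing acc with
  | zero => simp [rowLoop]
  | succ k ih =>
    rw [rowLoop, ih, sum_range_succ, Nat.shiftLeft_eq, Nat.shiftLeft_eq]
    ring

/-- The packed row. [folklore] -/
theorem row_eq (b c : ℕ) :
    row H s T b c = ∑ t ∈ range (2 * H + 1), entry T (absBal H t) b c * 2 ^ (s * t) := by
  rw [row, rowLoop_eq, zero_add]
  exact sum_loop_mirror H (fun a t ↦ entry T a b c * 2 ^ (s * t))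

/-- Unrolling the plane loop. [folklore] -/
theorem planeLoop_eq (c k acc : ℕ) : planeLoop H s T c k acc = acc +
    ∑ j ∈ range k, (row H s T (H - j) c * 2 ^ (s * (2 * (2 * H + 1)) * (H - j)) +
      if H - j = 0 then 0 else
        row H s T (H - j) c * 2 ^ (s * (2 * (2 * H + 1)) * (2 * H + 1 - (H - j)))) := by
  induction k generalizing acc with
  | zero => simp [planeLoop]
  | succ k ih =>
    rw [planeLoop, ih, sum_range_succ, Nat.shiftLeft_eq, Nat.shiftLeft_eq]
    ring

/-- The packed plane. [folklore] -/
theorem plane_eq (c : ℕ) : plane H s T c =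
    ∑ t₂ ∈ range (2 * H + 1), ∑ t₁ ∈ range (2 * H + 1),
      entry T (absBal H t₁) (absBal H t₂) c * 2 ^ (s * (t₁ + 2 * (2 * H + 1) * t₂)) := by
  rw [plane, planeLoop_eq, zero_add,
    sum_loop_mirror H (fun b t ↦ row H s T b c * 2 ^ (s * (2 * (2 * H + 1)) * t))]
  refine Finset.sum_congr rfl fun t₂ _ ↦ ?_
  rw [row_eq, sum_mul]
  refine Finset.sum_congr rfl fun t₁ _ ↦ ?_
  rw [mul_assoc, ← pow_add]
  congr 2
  ring

/-- Unrolling the cube loop. [folklore] -/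
theorem cubeLoop_eq (k acc : ℕ) : cubeLoop H s T k acc = acc +
    ∑ j ∈ range k, (plane H s T (H - j) * 2 ^ (s * (2 * (2 * H + 1)) ^ 2 * (H - j)) +
      if H - j = 0 then 0 else
        plane H s T (H - j) * 2 ^ (s * (2 * (2 * H + 1)) ^ 2 * (2 * H + 1 - (H - j)))) := by
  induction k generalizing acc with
  | zero => simp [cubeLoop]
  | succ k ih =>
    rw [cubeLoop, ih, sum_range_succ, Nat.shiftLeft_eq, Nat.shiftLeft_eq]
    ring

/-- The entry placed at cube slot `(t₁, t₂, t₃)`. [folklore] -/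
def cubeEntry (H T t₁ t₂ t₃ : ℕ) : ℕ := entry T (absBal H t₁) (absBal H t₂) (absBal H t₃)

/-- **The packed cube as a triple sum.** [folklore] -/
theorem cube_eq : cube H s T =
    ∑ t₃ ∈ range (2 * H + 1), ∑ t₂ ∈ range (2 * H + 1), ∑ t₁ ∈ range (2 * H + 1),
      cubeEntry H T t₁ t₂ t₃ *
        2 ^ (s * (t₁ + 2 * (2 * H + 1) * t₂ + (2 * (2 * H + 1)) ^ 2 * t₃)) := by
  rw [cube, cubeLoop_eq, zero_add,
    sum_loop_mirror H (fun c t ↦ plane H s T c * 2 ^ (s * (2 * (2 * H + 1)) ^ 2 * t))]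
  refine Finset.sum_congr rfl fun t₃ _ ↦ ?_
  rw [plane_eq, sum_mul]
  refine Finset.sum_congr rfl fun t₂ _ ↦ ?_
  rw [sum_mul]
  refine Finset.sum_congr rfl fun t₁ _ ↦ ?_
  rw [cubeEntry, mul_assoc, ← pow_add]
  congr 2
  ring

end Cube

/-! ## Three-dimensional arrays, products and the conversion to slots -/

section ThreeD

/-- The box `[0,n)³`. [folklore] -/
def box (n : ℕ) : Finset (ℕ × ℕ × ℕ) := range n ×ˢ range n ×ˢ range n

/-- Membership in the box. [folklore] -/
theorem mem_box {n : ℕ} {t : ℕ × ℕ × ℕ} : t ∈ box n ↔ t.1 < n ∧ t.2.1 < n ∧ t.2.2 < n := by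
  simp [box, mem_product, mem_range]

/-- Boxes are monotone. [folklore] -/
theorem box_subset_box {n n' : ℕ} (h : n ≤ n') : box n ⊆ box n' := by
  intro t ht
  rw [mem_box] at ht ⊢
  omega

/-- The slot index `t₁ + L t₂ + L² t₃`. [folklore] -/
def lidx (L : ℕ) (t : ℕ × ℕ × ℕ) : ℕ := t.1 + L * t.2.1 + L ^ 2 * t.2.2

/-- The slot index is additive. [folklore] -/
theorem lidx_add (L : ℕ) (t t' : ℕ × ℕ × ℕ) : lidx L (t + t') = lidx L t + lidx L t' := by
  simp only [lidx, Prod.fst_add, Prod.snd_add]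
  ring

/-- Sum over a box as an iterated sum. [folklore] -/
theorem sum_box_eq {M : Type*} [AddCommMonoid M] (n : ℕ) (F : ℕ × ℕ × ℕ → M) :
    ∑ t ∈ box n, F t = ∑ t₁ ∈ range n, ∑ t₂ ∈ range n, ∑ t₃ ∈ range n, F (t₁, t₂, t₃) := by
  rw [box, sum_product]
  exact Finset.sum_congr rfl fun t₁ _ ↦ by rw [sum_product]

/-- Reordering an iterated triple sum (outer and inner binders swapped). [folklore] -/
theorem sum_comm3 {M : Type*} [AddCommMonoid M] {α β γ : Type*} (A : Finset α) (B : Finset β)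
    (C : Finset γ) (F : α → β → γ → M) :
    ∑ c ∈ C, ∑ b ∈ B, ∑ a ∈ A, F a b c = ∑ a ∈ A, ∑ b ∈ B, ∑ c ∈ C, F a b c := by
  have h1 : ∀ c ∈ C, ∑ b ∈ B, ∑ a ∈ A, F a b c = ∑ a ∈ A, ∑ b ∈ B, F a b c :=
    fun c _ ↦ sum_comm
  rw [sum_congr rfl h1, sum_comm]
  exact sum_congr rfl fun a _ ↦ sum_comm

variable (H s : ℕ)

/-- The entry array of a table as a function on `ℕ³`. [folklore] -/
def cubeArr (T : ℕ) (t : ℕ × ℕ × ℕ) : ℕ := cubeEntry H T t.1 t.2.1 t.2.2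

/-- **The packed cube as a sum over the box.** [folklore] -/
theorem cube_eq_sum_box (T : ℕ) : cube H s T =
    ∑ t ∈ box (2 * H + 1), cubeArr H T t * 2 ^ (s * lidx (2 * (2 * H + 1)) t) := by
  rw [cube_eq, sum_box_eq, sum_comm3]
  simp only [cubeArr, lidx]

/-- The **linear (acyclic) convolution** of two arrays supported in the box `[0,n)³`. [folklore] -/
def conv3 (n : ℕ) (f g : ℕ × ℕ × ℕ → ℕ) (u : ℕ × ℕ × ℕ) : ℕ :=
  ∑ p ∈ (box n ×ˢ box n) with p.1 + p.2 = u, f p.1 * g p.2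

/-- The linear convolution of arrays in `[0,n)³` vanishes outside `[0,2n-1)³`. [folklore] -/
theorem conv3_eq_zero {n : ℕ} (f g : ℕ × ℕ × ℕ → ℕ) {u : ℕ × ℕ × ℕ} (hu : u ∉ box (2 * n - 1)) :
    conv3 n f g u = 0 := by
  unfold conv3
  refine Finset.sum_eq_zero fun p hp ↦ ?_
  exfalso
  rw [mem_filter, mem_product, mem_box, mem_box] at hp
  apply hu
  rw [mem_box, ← hp.2]
  simp only [Prod.fst_add, Prod.snd_add]
  omega

/-- **Product of packed boxes** = packed linear convolution. [folklore] -/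
theorem sum_box_mul_sum_box (n L s' : ℕ) (f g : ℕ × ℕ × ℕ → ℕ) :
    (∑ t ∈ box n, f t * 2 ^ (s' * lidx L t)) * (∑ t ∈ box n, g t * 2 ^ (s' * lidx L t)) =
      ∑ u ∈ box (2 * n - 1), conv3 n f g u * 2 ^ (s' * lidx L u) := by
  rw [sum_mul_sum, ← sum_product']
  have hmaps : ∀ p ∈ box n ×ˢ box n, p.1 + p.2 ∈ box (2 * n - 1) := by
    intro p hp
    rw [mem_product, mem_box, mem_box] at hp
    rw [mem_box]
    simp only [Prod.fst_add, Prod.snd_add]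
    omega
  rw [← sum_fiberwise_of_maps_to hmaps]
  refine Finset.sum_congr rfl fun u _ ↦ ?_
  rw [conv3, sum_mul]
  refine Finset.sum_congr rfl fun p hp ↦ ?_
  rw [mem_filter] at hp
  rw [mul_mul_mul_comm, ← pow_add, ← mul_add, ← lidx_add, hp.2]

/-- Iterating `range (a * b)`. [folklore] -/
theorem sum_range_mul' {M : Type*} [AddCommMonoid M] (f : ℕ → M) (a b : ℕ) :
    ∑ i ∈ range (a * b), f i = ∑ j ∈ range b, ∑ k ∈ range a, f (k + a * j) := by
  induction b with
  | zero => simp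
  | succ b ih =>
    rw [Nat.mul_succ, sum_range_add, ih, sum_range_succ]
    congr 1
    exact Finset.sum_congr rfl fun k _ ↦ by rw [add_comm]

/-- The slot digits of an array: `W (i % L, (i/L) % L, i / L²)`. [folklore] -/
def linArr (L : ℕ) (W : ℕ × ℕ × ℕ → ℕ) (i : ℕ) : ℕ := W (i % L, i / L % L, i / L ^ 2)

/-- Decoding the slot index. [folklore] -/
theorem linArr_lidx {L : ℕ} (W : ℕ × ℕ × ℕ → ℕ) {t : ℕ × ℕ × ℕ} (h1 : t.1 < L) (h2 : t.2.1 < L) :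
    linArr L W (lidx L t) = W t := by
  obtain ⟨t₁, t₂, t₃⟩ := t
  simp only at h1 h2
  have hL : 0 < L := by omega
  unfold linArr lidx
  simp only
  have e1 : (t₁ + L * t₂ + L ^ 2 * t₃) = t₁ + L * (t₂ + L * t₃) := by ring
  rw [e1, Nat.add_mul_mod_self_left, Nat.mod_eq_of_lt h1, Nat.add_mul_div_left _ _ hL,
    Nat.div_eq_of_lt h1, zero_add, Nat.add_mul_mod_self_left, Nat.mod_eq_of_lt h2, sq,
    ← Nat.div_div_eq_div_mul, Nat.add_mul_div_left _ _ hL, Nat.div_eq_of_lt h1, zero_add,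
    Nat.add_mul_div_left _ _ hL, Nat.div_eq_of_lt h2, zero_add]

/-- **Box sums are packed slot sums**: for `W` vanishing outside `box K` with `K ≤ L`,
`∑_{u ∈ box K} W u 2^{s·lidx u} = pack s (L² K) (linArr L W)`. [folklore] -/
theorem sum_box_eq_pack {L K s' : ℕ} (hK : K ≤ L) (W : ℕ × ℕ × ℕ → ℕ)
    (hW : ∀ u, u ∉ box K → W u = 0) :
    ∑ u ∈ box K, W u * 2 ^ (s' * lidx L u) = pack s' (L * L * K) (linArr L W) := by
  -- expand the pack as an iterated sum over `[0,L) × [0,L) × [0,K)`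
  have hpack : pack s' (L * L * K) (linArr L W) =
      ∑ t₃ ∈ range K, ∑ t₂ ∈ range L, ∑ t₁ ∈ range L,
        W (t₁, t₂, t₃) * 2 ^ (s' * lidx L (t₁, t₂, t₃)) := by
    unfold pack
    rw [show L * L * K = L * (L * K) by ring, sum_range_mul', sum_range_mul']
    refine Finset.sum_congr rfl fun t₃ _ ↦ Finset.sum_congr rfl fun t₂ h₂ ↦
      Finset.sum_congr rfl fun t₁ h₁ ↦ ?_
    rw [mem_range] at h₁ h₂
    have hidx : t₁ + L * (t₂ + L * t₃) = lidx L (t₁, t₂, t₃) := by simp only [lidx]; ring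
    rw [hidx, linArr_lidx W h₁ h₂]
  rw [hpack]
  -- extend the box sum by zero to `[0,L) × [0,L) × [0,K)` and iterate
  have hsub : box K ⊆ range L ×ˢ range L ×ˢ range K := by
    intro u hu
    rw [mem_box] at hu
    simp only [mem_product, mem_range]
    omega
  rw [sum_subset hsub (fun u _ hnot ↦ by rw [hW u hnot, zero_mul]), sum_product]
  simp_rw [sum_product]
  exact (sum_comm3 (range L) (range L) (range K)
    (fun t₁ t₂ t₃ ↦ W (t₁, t₂, t₃) * 2 ^ (s' * lidx L (t₁, t₂, t₃)))).symm

end ThreeD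

/-! ## Digit bounds (Cauchy–Schwarz) and the sum of squares -/

section Bounds

/-- **Cauchy–Schwarz for the linear convolution**: `(f ⋆ g)(u)² ≤ ‖f‖₂² ‖g‖₂²`. [folklore] -/
theorem conv3_sq_le (n : ℕ) (f g : ℕ × ℕ × ℕ → ℕ) (u : ℕ × ℕ × ℕ) :
    conv3 n f g u ^ 2 ≤ (∑ t ∈ box n, f t ^ 2) * ∑ t ∈ box n, g t ^ 2 := by
  set P := (box n ×ˢ box n).filter (fun p ↦ p.1 + p.2 = u) with hP
  have hcs := sum_mul_sq_le_sq_mul_sq P (fun p ↦ f p.1) (fun p ↦ g p.2)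
  have hinj1 : Set.InjOn Prod.fst (P : Set ((ℕ × ℕ × ℕ) × (ℕ × ℕ × ℕ))) := by
    intro p hp q hq h
    rw [Finset.mem_coe, hP, mem_filter] at hp hq
    refine Prod.ext h ?_
    have := hp.2.trans hq.2.symm
    rw [h] at this
    exact add_left_cancel this
  have hinj2 : Set.InjOn Prod.snd (P : Set ((ℕ × ℕ × ℕ) × (ℕ × ℕ × ℕ))) := by
    intro p hp q hq h
    rw [Finset.mem_coe, hP, mem_filter] at hp hq
    refine Prod.ext ?_ h
    have := hp.2.trans hq.2.symm
    rw [h] at this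
    exact add_right_cancel this
  have h1 : ∑ p ∈ P, f p.1 ^ 2 ≤ ∑ t ∈ box n, f t ^ 2 := by
    rw [← sum_image (g := Prod.fst) (f := fun t ↦ f t ^ 2) hinj1]
    refine sum_le_sum_of_subset fun t ht ↦ ?_
    rw [mem_image] at ht
    obtain ⟨p, hp, rfl⟩ := ht
    rw [hP, mem_filter, mem_product] at hp
    exact hp.1.1
  have h2 : ∑ p ∈ P, g p.2 ^ 2 ≤ ∑ t ∈ box n, g t ^ 2 := by
    rw [← sum_image (g := Prod.snd) (f := fun t ↦ g t ^ 2) hinj2]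
    refine sum_le_sum_of_subset fun t ht ↦ ?_
    rw [mem_image] at ht
    obtain ⟨p, hp, rfl⟩ := ht
    rw [hP, mem_filter, mem_product] at hp
    exact hp.1.2
  calc conv3 n f g u ^ 2 = (∑ p ∈ P, f p.1 * g p.2) ^ 2 := by rw [conv3]
    _ ≤ (∑ p ∈ P, f p.1 ^ 2) * ∑ p ∈ P, g p.2 ^ 2 := hcs
    _ ≤ (∑ t ∈ box n, f t ^ 2) * ∑ t ∈ box n, g t ^ 2 := Nat.mul_le_mul h1 h2

/-- A linear convolution digit is at most a common bound of the sums of squares. [folklore] -/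
theorem conv3_le {n S : ℕ} {f g : ℕ × ℕ × ℕ → ℕ} (hf : ∑ t ∈ box n, f t ^ 2 ≤ S)
    (hg : ∑ t ∈ box n, g t ^ 2 ≤ S) (u : ℕ × ℕ × ℕ) : conv3 n f g u ≤ S := by
  have h := (conv3_sq_le n f g u).trans (Nat.mul_le_mul hf hg)
  rw [← sq] at h
  exact (Nat.pow_le_pow_iff_left (by norm_num)).mp h

/-- Twice a mixed linear convolution digit is at most the sum of the sums of squares. [folklore] -/
theorem two_mul_conv3_le {n SP SN : ℕ} {f g : ℕ × ℕ × ℕ → ℕ} (hf : ∑ t ∈ box n, f t ^ 2 ≤ SP)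
    (hg : ∑ t ∈ box n, g t ^ 2 ≤ SN) (u : ℕ × ℕ × ℕ) : 2 * conv3 n f g u ≤ SP + SN := by
  have h := (conv3_sq_le n f g u).trans (Nat.mul_le_mul hf hg)
  have h4 : (2 * conv3 n f g u) ^ 2 ≤ (SP + SN) ^ 2 := by
    have : 4 * (SP * SN) ≤ (SP + SN) ^ 2 := by
      rcases le_total SP SN with hle | hle
      · obtain ⟨d, rfl⟩ := Nat.exists_eq_add_of_le hle; ring_nf; nlinarith
      · obtain ⟨d, rfl⟩ := Nat.exists_eq_add_of_le hle; ring_nf; nlinarith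
    calc (2 * conv3 n f g u) ^ 2 = 4 * conv3 n f g u ^ 2 := by ring
      _ ≤ 4 * (SP * SN) := Nat.mul_le_mul_left 4 h
      _ ≤ (SP + SN) ^ 2 := this
  exact (Nat.pow_le_pow_iff_left (by norm_num)).mp h4

variable (H : ℕ)

/-- Multiplicity `1`/`2` as `F + (if a = 0 then 0 else F)`. [folklore] -/
theorem wt_mul (a F : ℕ) : (if a = 0 then 1 else 2) * F = F + if a = 0 then 0 else F := by
  split_ifs <;> ring

/-- Unrolling the sum-of-squares row loop. [folklore] -/
theorem ssRowLoop_eq (T b c k acc : ℕ) : ssRowLoop H T b c k acc =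
    acc + ∑ j ∈ range k, (if H - j = 0 then 1 else 2) * entry T (H - j) b c ^ 2 := by
  induction k generalizing acc with
  | zero => simp [ssRowLoop]
  | succ k ih => rw [ssRowLoop, ih, sum_range_succ]; ring

/-- The sum-of-squares row loop computes a full row of squares. [folklore] -/
theorem ssRow_eq (T b c : ℕ) : ssRowLoop H T b c (H + 1) 0 =
    ∑ t ∈ range (2 * H + 1), entry T (absBal H t) b c ^ 2 := by
  rw [ssRowLoop_eq, zero_add, ← sum_loop_mirror H (fun a _ ↦ entry T a b c ^ 2)]
  exact Finset.sum_congr rfl fun j _ ↦ wt_mul _ _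

/-- Unrolling the sum-of-squares plane loop. [folklore] -/
theorem ssPlaneLoop_eq (T c k acc : ℕ) : ssPlaneLoop H T c k acc =
    acc + ∑ j ∈ range k, (if H - j = 0 then 1 else 2) * ssRowLoop H T (H - j) c (H + 1) 0 := by
  induction k generalizing acc with
  | zero => simp [ssPlaneLoop]
  | succ k ih => rw [ssPlaneLoop, ih, sum_range_succ]; ring

/-- The sum-of-squares plane loop computes a full plane of squares. [folklore] -/
theorem ssPlane_eq (T c : ℕ) : ssPlaneLoop H T c (H + 1) 0 =
    ∑ t₂ ∈ range (2 * H + 1), ∑ t₁ ∈ range (2 * H + 1),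
      entry T (absBal H t₁) (absBal H t₂) c ^ 2 := by
  rw [ssPlaneLoop_eq, zero_add]
  refine (Finset.sum_congr rfl fun j _ ↦ wt_mul _ _).trans ?_
  refine (sum_loop_mirror H (fun b _ ↦ ssRowLoop H T b c (H + 1) 0)).trans ?_
  exact Finset.sum_congr rfl fun t₂ _ ↦ ssRow_eq H T _ c

/-- Unrolling the sum-of-squares cube loop. [folklore] -/
theorem ssCubeLoop_eq (T k acc : ℕ) : ssCubeLoop H T k acc =
    acc + ∑ j ∈ range k, (if H - j = 0 then 1 else 2) * ssPlaneLoop H T (H - j) (H + 1) 0 := by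
  induction k generalizing acc with
  | zero => simp [ssCubeLoop]
  | succ k ih => rw [ssCubeLoop, ih, sum_range_succ]; ring

/-- **The computed sum of squares.** [folklore] -/
theorem sumSq_eq (T : ℕ) : sumSq H T = ∑ t ∈ box (2 * H + 1), cubeArr H T t ^ 2 := by
  rw [sumSq, ssCubeLoop_eq, zero_add, sum_box_eq, ← sum_comm3]
  refine (Finset.sum_congr rfl fun j _ ↦ wt_mul _ _).trans ?_
  refine (sum_loop_mirror H (fun c _ ↦ ssPlaneLoop H T c (H + 1) 0)).trans ?_
  refine Finset.sum_congr rfl fun t₃ _ ↦ ?_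
  rw [ssPlane_eq]
  rfl

end Bounds

/-! ## Extraction of the cyclic digits and the scan -/

section Extract

/-- The **cyclic fold** of an array: `∑_{e ∈ {0,1}³} W (t + N e)`. [folklore] -/
def cyc (N : ℕ) (W : ℕ × ℕ × ℕ → ℕ) (t : ℕ × ℕ × ℕ) : ℕ :=
  ∑ e ∈ box 2, W (t.1 + N * e.1, t.2.1 + N * e.2.1, t.2.2 + N * e.2.2)

/-- The cyclic fold as an explicit eight-term sum. [folklore] -/
theorem cyc_eq (N : ℕ) (W : ℕ × ℕ × ℕ → ℕ) (t₁ t₂ t₃ : ℕ) : cyc N W (t₁, t₂, t₃) =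
    W (t₁, t₂, t₃) + W (t₁, t₂, t₃ + N) + (W (t₁, t₂ + N, t₃) + W (t₁, t₂ + N, t₃ + N)) +
    (W (t₁ + N, t₂, t₃) + W (t₁ + N, t₂, t₃ + N) +
      (W (t₁ + N, t₂ + N, t₃) + W (t₁ + N, t₂ + N, t₃ + N))) := by
  simp only [cyc, box, sum_product, sum_range_succ, sum_range_zero, zero_add, mul_zero, add_zero,
    mul_one]

variable {s : ℕ}

/-- One window-and-fold level. [folklore] -/
theorem window_fold {K a k j B : ℕ} {g : ℕ → ℕ} (hg : ∀ i, g i ≤ B) (hB : 2 * B < 2 ^ s)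
    (hj : j = k + k) (hak : a + j ≤ K) :
    foldAt s (lowSlots s (dropSlots s (pack s K g) a) j) k =
      pack s k (fun i ↦ g (a + i) + g (a + k + i)) := by
  subst hj
  have hg' : ∀ i, g i < 2 ^ s := fun i ↦ by have := hg i; omega
  rw [lowSlots_eq, dropSlots_eq, pack_window (fun i _ ↦ hg' i) hak, foldAt_eq,
    pack_fold (fun i _ ↦ hg' _) le_rfl]
  refine pack_congr fun i hi ↦ ?_
  rw [if_pos hi, add_assoc]

variable {N S : ℕ} {W : ℕ × ℕ × ℕ → ℕ}

/-- Level 0: folding the packed linear convolution at `N L²` slots. [folklore] -/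
theorem fold_cube_eq (hW : ∀ u, W u ≤ S) (hS : 8 * S < 2 ^ s) :
    foldAt s (pack s (2 * N * (2 * N) * (2 * N - 1)) (linArr (2 * N) W)) (N * (2 * N) ^ 2) =
      pack s (N * (2 * N) ^ 2) (fun i ↦ linArr (2 * N) W i +
        if i < (N - 1) * (2 * N) ^ 2 then linArr (2 * N) W (N * (2 * N) ^ 2 + i) else 0) := by
  have hK : 2 * N * (2 * N) * (2 * N - 1) = N * (2 * N) ^ 2 + (N - 1) * (2 * N) ^ 2 := by
    rcases N with _ | n
    · simp
    · rw [show 2 * (n + 1) - 1 = (n + 1) + n by omega, Nat.add_sub_cancel]; ring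
  have hg : ∀ i, linArr (2 * N) W i < 2 ^ s := fun i ↦ by
    have := hW (i % (2 * N), i / (2 * N) % (2 * N), i / (2 * N) ^ 2); unfold linArr; omega
  rw [hK, foldAt_eq, pack_fold (fun i _ ↦ hg i) (Nat.mul_le_mul_right _ (Nat.sub_le N 1))]

/-- **The three-level extraction of a cyclic digit** from the packed linear convolution. [folklore] -/
theorem extract_cyc (hW : ∀ u, W u ≤ S) (hW0 : ∀ u, u ∉ box (2 * N - 1) → W u = 0)
    (hS : 8 * S < 2 ^ s) {t₁ t₂ t₃ : ℕ} (h₁ : t₁ < N) (h₂ : t₂ < N) (h₃ : t₃ < N) :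
    lowSlots s (dropSlots s
      (foldAt s (lowSlots s (dropSlots s
        (foldAt s (lowSlots s (dropSlots s
          (foldAt s (pack s (2 * N * (2 * N) * (2 * N - 1)) (linArr (2 * N) W)) (N * (2 * N) ^ 2))
          ((2 * N) ^ 2 * t₃)) ((2 * N) ^ 2)) (N * (2 * N)))
        (2 * N * t₂)) (2 * N)) N)
      t₁) 1 = cyc N W (t₁, t₂, t₃) := by
  rw [fold_cube_eq hW hS]
  set g := linArr (2 * N) W with hg
  set g₁ : ℕ → ℕ := fun i ↦ g i + if i < (N - 1) * (2 * N) ^ 2 then g (N * (2 * N) ^ 2 + i) else 0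
    with hg₁
  have hgS : ∀ i, g i ≤ S := fun i ↦ hW _
  have hg₁S : ∀ i, g₁ i ≤ 2 * S := by
    intro i; simp only [hg₁]; split_ifs <;> linarith [hgS i, hgS (N * (2 * N) ^ 2 + i)]
  -- level 1: plane `t₃`
  have h1 := window_fold (s := s) (a := (2 * N) ^ 2 * t₃) (k := N * (2 * N)) (j := (2 * N) ^ 2)
    (K := N * (2 * N) ^ 2) hg₁S (by omega) (by ring) (by nlinarith)
  rw [h1]
  set g₂ : ℕ → ℕ := fun i ↦ g₁ ((2 * N) ^ 2 * t₃ + i) + g₁ ((2 * N) ^ 2 * t₃ + N * (2 * N) + i)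
    with hg₂
  have hg₂S : ∀ i, g₂ i ≤ 4 * S := fun i ↦ by
    simp only [hg₂]
    linarith [hg₁S ((2 * N) ^ 2 * t₃ + i), hg₁S ((2 * N) ^ 2 * t₃ + N * (2 * N) + i)]
  -- level 2: row `t₂`
  have h2 := window_fold (s := s) (a := 2 * N * t₂) (k := N) (j := 2 * N) (K := N * (2 * N)) hg₂S
    (by omega) (by ring) (by nlinarith)
  rw [h2]
  set g₃ : ℕ → ℕ := fun i ↦ g₂ (2 * N * t₂ + i) + g₂ (2 * N * t₂ + N + i) with hg₃
  have hg₃S : ∀ i, g₃ i < 2 ^ s := fun i ↦ by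
    simp only [hg₃]; linarith [hg₂S (2 * N * t₂ + i), hg₂S (2 * N * t₂ + N + i)]
  -- level 3: digit `t₁`
  rw [lowSlots_eq, dropSlots_eq, mul_one, pack_digit (fun i _ ↦ hg₃S i) h₁]
  -- unfold the digit into the eight cyclic terms
  have key : ∀ e₁ e₂, e₁ ≤ 1 → e₂ ≤ 1 →
      g₁ ((2 * N) ^ 2 * t₃ + N * (2 * N) * e₂ + (2 * N * t₂ + N * e₁ + t₁)) =
        W (t₁ + N * e₁, t₂ + N * e₂, t₃) + W (t₁ + N * e₁, t₂ + N * e₂, t₃ + N) := by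
    intro e₁ e₂ he₁ he₂
    have hb1 : N * e₁ ≤ N := by nlinarith
    have hb2 : N * e₂ ≤ N := by nlinarith
    have hc1 : t₁ + N * e₁ < 2 * N := by omega
    have hc2 : t₂ + N * e₂ < 2 * N := by omega
    have hidx : (2 * N) ^ 2 * t₃ + N * (2 * N) * e₂ + (2 * N * t₂ + N * e₁ + t₁) =
        lidx (2 * N) (t₁ + N * e₁, t₂ + N * e₂, t₃) := by simp only [lidx]; ring
    have hidx' : N * (2 * N) ^ 2 + lidx (2 * N) (t₁ + N * e₁, t₂ + N * e₂, t₃) =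
        lidx (2 * N) (t₁ + N * e₁, t₂ + N * e₂, t₃ + N) := by simp only [lidx]; ring
    rw [hidx]
    show g _ + (if _ then g _ else 0) = _
    rw [hg, linArr_lidx W hc1 hc2, hidx', linArr_lidx W hc1 hc2]
    split_ifs with hlt
    · rfl
    · rw [hW0 (t₁ + N * e₁, t₂ + N * e₂, t₃ + N) ?_]
      intro hmem
      rw [mem_box] at hmem
      apply hlt
      -- `t₃ + N < 2N - 1` gives `t₃ + 1 ≤ N - 1`, hence the index is below `(N-1) L²`
      have ht3 : t₃ + 1 ≤ N - 1 := by simp only at hmem; omega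
      have hlow : t₁ + N * e₁ + 2 * N * (t₂ + N * e₂) < (2 * N) ^ 2 := by nlinarith
      calc lidx (2 * N) (t₁ + N * e₁, t₂ + N * e₂, t₃)
          = t₁ + N * e₁ + 2 * N * (t₂ + N * e₂) + (2 * N) ^ 2 * t₃ := by simp only [lidx]
        _ < (2 * N) ^ 2 + (2 * N) ^ 2 * t₃ := by omega
        _ = (2 * N) ^ 2 * (t₃ + 1) := by ring
        _ ≤ (2 * N) ^ 2 * (N - 1) := Nat.mul_le_mul_left _ ht3
        _ = (N - 1) * (2 * N) ^ 2 := by ring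
  simp only [hg₃, hg₂]
  rw [show (2 * N) ^ 2 * t₃ + (2 * N * t₂ + t₁) =
      (2 * N) ^ 2 * t₃ + N * (2 * N) * 0 + (2 * N * t₂ + N * 0 + t₁) by ring,
    show (2 * N) ^ 2 * t₃ + N * (2 * N) + (2 * N * t₂ + t₁) =
      (2 * N) ^ 2 * t₃ + N * (2 * N) * 1 + (2 * N * t₂ + N * 0 + t₁) by ring,
    show (2 * N) ^ 2 * t₃ + (2 * N * t₂ + N + t₁) =
      (2 * N) ^ 2 * t₃ + N * (2 * N) * 0 + (2 * N * t₂ + N * 1 + t₁) by ring,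
    show (2 * N) ^ 2 * t₃ + N * (2 * N) + (2 * N * t₂ + N + t₁) =
      (2 * N) ^ 2 * t₃ + N * (2 * N) * 1 + (2 * N * t₂ + N * 1 + t₁) by ring,
    key 0 0 zero_le_one zero_le_one, key 0 1 zero_le_one le_rfl,
    key 1 0 le_rfl zero_le_one, key 1 1 le_rfl le_rfl, cyc_eq]
  simp only [mul_zero, add_zero, mul_one]

end Extract

/-! ## The scan and the specification of `compute` -/

section ScanSpec

/-- Correction-mass contribution of one point. [folklore] -/
def corrC (w a b cl : ℕ) : ℕ :=
  if cl = 1 then w * (if b ≤ a then a - b else b - a)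
  else if cl = 2 then (if b ≤ a then 0 else w * (b - a)) else 0

/-- Positive-mass contribution of one point. [folklore] -/
def posC (w a b cl : ℕ) : ℕ := if cl = 2 then (if b ≤ a then w * (a - b) else 0) else 0

/-- One scan step adds the point's contributions. [folklore] -/
theorem digitStep_eq (w a b cl : ℕ) (acc : Acc) :
    digitStep w a b cl acc = ⟨acc.corr + corrC w a b cl, acc.pos + posC w a b cl⟩ := by
  unfold digitStep corrC posC
  by_cases h1 : cl = 1
  · simp [h1]
  · by_cases h2 : cl = 2
    · subst h2
      simp only [if_neg h1, if_true]
      split_ifs <;> simp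
    · simp [h1, h2]

variable (H s R : ℕ)

/-- The contributions of the digits `t₁ = H - j`, `j < k`, of a pair of folded rows. [folklore] -/
def rowCorr (rA rB t₂ t₃ k : ℕ) : ℕ := ∑ j ∈ range k, corrC (wt (H - j) * wt t₂ * wt t₃)
  (lowSlots s (dropSlots s rA (H - j)) 1) (lowSlots s (dropSlots s rB (H - j)) 1) (cls H R (H - j) t₂ t₃)

/-- Positive-mass contributions of the digits `t₁ = H - j`, `j < k`, of a pair of folded rows. [folklore] -/
def rowPos (rA rB t₂ t₃ k : ℕ) : ℕ := ∑ j ∈ range k, posC (wt (H - j) * wt t₂ * wt t₃)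
  (lowSlots s (dropSlots s rA (H - j)) 1) (lowSlots s (dropSlots s rB (H - j)) 1) (cls H R (H - j) t₂ t₃)

/-- Unrolling the row scan. [folklore] -/
theorem rowScan_eq (rA rB t₂ t₃ k : ℕ) (acc : Acc) : rowScan H s R rA rB t₂ t₃ k acc =
    ⟨acc.corr + rowCorr H s R rA rB t₂ t₃ k, acc.pos + rowPos H s R rA rB t₂ t₃ k⟩ := by
  induction k generalizing acc with
  | zero => simp [rowScan, rowCorr, rowPos]
  | succ k ih =>
    rw [rowScan, ih, digitStep_eq]
    simp only [rowCorr, rowPos, sum_range_succ]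
    congr 1 <;> ring

/-- The row handed to `rowScan` for the row index `t₂` of a folded plane `pX`. [folklore] -/
def rowOf (pX t₂ : ℕ) : ℕ :=
  foldAt s (lowSlots s (dropSlots s pX (2 * (2 * H + 1) * t₂)) (2 * (2 * H + 1))) (2 * H + 1)

/-- The plane handed to `planeScan` for the plane index `t₃` of a folded cube `cX`. [folklore] -/
def planeOf (cX t₃ : ℕ) : ℕ :=
  foldAt s (lowSlots s (dropSlots s cX ((2 * (2 * H + 1)) ^ 2 * t₃)) ((2 * (2 * H + 1)) ^ 2))
    ((2 * H + 1) * (2 * (2 * H + 1)))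

/-- `digitAt` as row-of-plane extraction. [folklore] -/
theorem digitAt_eq (cX t₁ t₂ t₃ : ℕ) : digitAt H s cX t₁ t₂ t₃ =
    lowSlots s (dropSlots s (rowOf H s (planeOf H s cX t₃) t₂) t₁) 1 := rfl

/-- The contributions of the rows `t₂ = H - j₂`, `j₂ < k`, of a pair of folded planes. [folklore] -/
def planeCorr (pA pB t₃ k : ℕ) : ℕ :=
  ∑ j₂ ∈ range k, rowCorr H s R (rowOf H s pA (H - j₂)) (rowOf H s pB (H - j₂)) (H - j₂) t₃ (H + 1)

/-- Positive-mass contributions of the rows `t₂ = H - j₂`, `j₂ < k`. [folklore] -/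
def planePos (pA pB t₃ k : ℕ) : ℕ :=
  ∑ j₂ ∈ range k, rowPos H s R (rowOf H s pA (H - j₂)) (rowOf H s pB (H - j₂)) (H - j₂) t₃ (H + 1)

/-- Unrolling the plane scan. [folklore] -/
theorem planeScan_eq (pA pB t₃ k : ℕ) (acc : Acc) : planeScan H s R pA pB t₃ k acc =
    ⟨acc.corr + planeCorr H s R pA pB t₃ k, acc.pos + planePos H s R pA pB t₃ k⟩ := by
  induction k generalizing acc with
  | zero => simp [planeScan, planeCorr, planePos]
  | succ k ih =>
    rw [planeScan, ih, rowScan_eq]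
    simp only [planeCorr, planePos, sum_range_succ, rowOf]
    congr 1 <;> ring

/-- The contributions of the planes `t₃ = H - j₃`, `j₃ < k`, of a pair of folded cubes. [folklore] -/
def cubeCorr (cA cB k : ℕ) : ℕ :=
  ∑ j₃ ∈ range k, planeCorr H s R (planeOf H s cA (H - j₃)) (planeOf H s cB (H - j₃)) (H - j₃) (H + 1)

/-- Positive-mass contributions of the planes `t₃ = H - j₃`, `j₃ < k`. [folklore] -/
def cubePos (cA cB k : ℕ) : ℕ :=
  ∑ j₃ ∈ range k, planePos H s R (planeOf H s cA (H - j₃)) (planeOf H s cB (H - j₃)) (H - j₃) (H + 1)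

/-- Unrolling the cube scan. [folklore] -/
theorem cubeScan_eq (cA cB k : ℕ) (acc : Acc) : cubeScan H s R cA cB k acc =
    ⟨acc.corr + cubeCorr H s R cA cB k, acc.pos + cubePos H s R cA cB k⟩ := by
  induction k generalizing acc with
  | zero => simp [cubeScan, cubeCorr, cubePos]
  | succ k ih =>
    rw [cubeScan, ih, planeScan_eq]
    simp only [cubeCorr, cubePos, sum_range_succ, planeOf]
    congr 1 <;> ring

/-- The full scan, unrolled into a triple sum in loop order. [folklore] -/
theorem cubeCorr_eq (cA cB : ℕ) : cubeCorr H s R cA cB (H + 1) =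
    ∑ j₃ ∈ range (H + 1), ∑ j₂ ∈ range (H + 1), ∑ j ∈ range (H + 1),
      corrC (wt (H - j) * wt (H - j₂) * wt (H - j₃))
        (digitAt H s cA (H - j) (H - j₂) (H - j₃)) (digitAt H s cB (H - j) (H - j₂) (H - j₃))
        (cls H R (H - j) (H - j₂) (H - j₃)) := by
  simp only [cubeCorr, planeCorr, rowCorr, digitAt_eq]

/-- The full positive-mass scan as a triple sum in loop order. [folklore] -/
theorem cubePos_eq (cA cB : ℕ) : cubePos H s R cA cB (H + 1) =
    ∑ j₃ ∈ range (H + 1), ∑ j₂ ∈ range (H + 1), ∑ j ∈ range (H + 1),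
      posC (wt (H - j) * wt (H - j₂) * wt (H - j₃))
        (digitAt H s cA (H - j) (H - j₂) (H - j₃)) (digitAt H s cB (H - j) (H - j₂) (H - j₃))
        (cls H R (H - j) (H - j₂) (H - j₃)) := by
  simp only [cubePos, planePos, rowPos, digitAt_eq]

/-- Reflecting a triple loop sum into box order. [folklore] -/
theorem sum_reflect3 {M : Type*} [AddCommMonoid M] (H : ℕ) (F : ℕ → ℕ → ℕ → M) :
    ∑ j₃ ∈ range (H + 1), ∑ j₂ ∈ range (H + 1), ∑ j ∈ range (H + 1), F (H - j) (H - j₂) (H - j₃) =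
      ∑ t₃ ∈ range (H + 1), ∑ t₂ ∈ range (H + 1), ∑ t₁ ∈ range (H + 1), F t₁ t₂ t₃ := by
  have h : ∀ (G : ℕ → M), ∑ j ∈ range (H + 1), G (H - j) = ∑ t ∈ range (H + 1), G t := by
    intro G
    conv_rhs => rw [← sum_range_reflect]
    exact Finset.sum_congr rfl fun j _ ↦ by rw [show H + 1 - 1 - j = H - j by omega]
  rw [h (fun t₃ ↦ ∑ j₂ ∈ range (H + 1), ∑ j ∈ range (H + 1), F (H - j) (H - j₂) t₃)]
  refine Finset.sum_congr rfl fun t₃ _ ↦ ?_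
  rw [h (fun t₂ ↦ ∑ j ∈ range (H + 1), F (H - j) t₂ t₃)]
  refine Finset.sum_congr rfl fun t₂ _ ↦ ?_
  exact h (fun t₁ ↦ F t₁ t₂ t₃)

variable (TP TN : ℕ)

/-- The digits of `A = β⁺∗β⁺ + β⁻∗β⁻` (linear convolutions). [folklore] -/
def arrA (u : ℕ × ℕ × ℕ) : ℕ :=
  conv3 (2 * H + 1) (cubeArr H TP) (cubeArr H TP) u + conv3 (2 * H + 1) (cubeArr H TN) (cubeArr H TN) u

/-- The digits of `B = β⁺∗β⁻ + β⁻∗β⁺`. [folklore] -/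
def arrB (u : ℕ × ℕ × ℕ) : ℕ :=
  conv3 (2 * H + 1) (cubeArr H TP) (cubeArr H TN) u + conv3 (2 * H + 1) (cubeArr H TN) (cubeArr H TP) u

/-- `arrA` vanishes outside `[0, 2N-1)³`. [folklore] -/
theorem arrA_eq_zero (u : ℕ × ℕ × ℕ) (hu : u ∉ box (2 * (2 * H + 1) - 1)) : arrA H TP TN u = 0 := by
  simp [arrA, conv3_eq_zero _ _ hu]

/-- `arrB` vanishes outside `[0, 2N-1)³`. [folklore] -/
theorem arrB_eq_zero (u : ℕ × ℕ × ℕ) (hu : u ∉ box (2 * (2 * H + 1) - 1)) : arrB H TP TN u = 0 := by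
  simp [arrB, conv3_eq_zero _ _ hu]

/-- The digits of `A` are bounded by the sum of squares of the entries. [folklore] -/
theorem arrA_le (u : ℕ × ℕ × ℕ) : arrA H TP TN u ≤ sumSq H TP + sumSq H TN := by
  rw [sumSq_eq, sumSq_eq, arrA]
  exact Nat.add_le_add (conv3_le le_rfl le_rfl u) (conv3_le le_rfl le_rfl u)

/-- The digits of `B` are bounded by the sum of squares of the entries. [folklore] -/
theorem arrB_le (u : ℕ × ℕ × ℕ) : arrB H TP TN u ≤ sumSq H TP + sumSq H TN := by
  rw [sumSq_eq, sumSq_eq, arrB]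
  have h1 := two_mul_conv3_le (n := 2 * H + 1) (f := cubeArr H TP) (g := cubeArr H TN)
    (SP := ∑ t ∈ box (2 * H + 1), cubeArr H TP t ^ 2) (SN := ∑ t ∈ box (2 * H + 1), cubeArr H TN t ^ 2)
    le_rfl le_rfl u
  have h2 := two_mul_conv3_le (n := 2 * H + 1) (f := cubeArr H TN) (g := cubeArr H TP)
    (SP := ∑ t ∈ box (2 * H + 1), cubeArr H TN t ^ 2) (SN := ∑ t ∈ box (2 * H + 1), cubeArr H TP t ^ 2)
    le_rfl le_rfl u
  omega

/-- **The packed `A`.** [folklore] -/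
theorem packA_eq : cube H s TP * cube H s TP + cube H s TN * cube H s TN =
    pack s (2 * (2 * H + 1) * (2 * (2 * H + 1)) * (2 * (2 * H + 1) - 1))
      (linArr (2 * (2 * H + 1)) (arrA H TP TN)) := by
  rw [cube_eq_sum_box, cube_eq_sum_box, sum_box_mul_sum_box, sum_box_mul_sum_box,
    ← sum_box_eq_pack (by omega) _ (arrA_eq_zero H TP TN), ← sum_add_distrib]
  refine Finset.sum_congr rfl fun u _ ↦ ?_
  rw [arrA, add_mul]

/-- **The packed `B`.** [folklore] -/
theorem packB_eq : 2 * (cube H s TP * cube H s TN) =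
    pack s (2 * (2 * H + 1) * (2 * (2 * H + 1)) * (2 * (2 * H + 1) - 1))
      (linArr (2 * (2 * H + 1)) (arrB H TP TN)) := by
  rw [show 2 * (cube H s TP * cube H s TN) =
    cube H s TP * cube H s TN + cube H s TN * cube H s TP by ring]
  rw [cube_eq_sum_box, cube_eq_sum_box, sum_box_mul_sum_box, sum_box_mul_sum_box,
    ← sum_box_eq_pack (by omega) _ (arrB_eq_zero H TP TN), ← sum_add_distrib]
  refine Finset.sum_congr rfl fun u _ ↦ ?_
  rw [arrB, add_mul]

variable {H s TP TN}

/-- The scanned digits of `A` are the cyclic folds of `arrA`. [folklore] -/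
theorem digitAt_A (hS : 8 * (sumSq H TP + sumSq H TN) < 2 ^ s) {t₁ t₂ t₃ : ℕ} (h₁ : t₁ ≤ H)
    (h₂ : t₂ ≤ H) (h₃ : t₃ ≤ H) :
    digitAt H s (foldAt s (cube H s TP * cube H s TP + cube H s TN * cube H s TN)
      ((2 * H + 1) * (2 * (2 * H + 1)) ^ 2)) t₁ t₂ t₃ = cyc (2 * H + 1) (arrA H TP TN) (t₁, t₂, t₃) := by
  rw [packA_eq, digitAt]
  exact extract_cyc (arrA_le H TP TN) (arrA_eq_zero H TP TN) hS (by omega) (by omega) (by omega)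

/-- The scanned digits of `B` are the cyclic folds of `arrB`. [folklore] -/
theorem digitAt_B (hS : 8 * (sumSq H TP + sumSq H TN) < 2 ^ s) {t₁ t₂ t₃ : ℕ} (h₁ : t₁ ≤ H)
    (h₂ : t₂ ≤ H) (h₃ : t₃ ≤ H) :
    digitAt H s (foldAt s (2 * (cube H s TP * cube H s TN))
      ((2 * H + 1) * (2 * (2 * H + 1)) ^ 2)) t₁ t₂ t₃ = cyc (2 * H + 1) (arrB H TP TN) (t₁, t₂, t₃) := by
  rw [packB_eq, digitAt]
  exact extract_cyc (arrB_le H TP TN) (arrB_eq_zero H TP TN) hS (by omega) (by omega) (by omega)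

variable (H s TP TN)

/-- **Specification of `compute`**: the accumulated correction and positive masses are the
octant sums (with multiplicities `wt`) of the per-point contributions of the cyclic
autoconvolution digits `cyc arrA - cyc arrB`; the origin digits and the sum of squares. [folklore] -/
theorem compute_spec (hS : 8 * (sumSq H TP + sumSq H TN) < 2 ^ s) :
    (compute H s R TP TN).corr = ∑ t₃ ∈ range (H + 1), ∑ t₂ ∈ range (H + 1), ∑ t₁ ∈ range (H + 1),
        corrC (wt t₁ * wt t₂ * wt t₃) (cyc (2 * H + 1) (arrA H TP TN) (t₁, t₂, t₃))
          (cyc (2 * H + 1) (arrB H TP TN) (t₁, t₂, t₃)) (cls H R t₁ t₂ t₃) ∧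
    (compute H s R TP TN).pos = ∑ t₃ ∈ range (H + 1), ∑ t₂ ∈ range (H + 1), ∑ t₁ ∈ range (H + 1),
        posC (wt t₁ * wt t₂ * wt t₃) (cyc (2 * H + 1) (arrA H TP TN) (t₁, t₂, t₃))
          (cyc (2 * H + 1) (arrB H TP TN) (t₁, t₂, t₃)) (cls H R t₁ t₂ t₃) ∧
    (compute H s R TP TN).a0 = cyc (2 * H + 1) (arrA H TP TN) (0, 0, 0) ∧
    (compute H s R TP TN).b0 = cyc (2 * H + 1) (arrB H TP TN) (0, 0, 0) ∧
    (compute H s R TP TN).ssq = sumSq H TP + sumSq H TN := by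
  set XA := foldAt s (cube H s TP * cube H s TP + cube H s TN * cube H s TN)
    ((2 * H + 1) * (2 * (2 * H + 1)) ^ 2) with hXA
  set XB := foldAt s (2 * (cube H s TP * cube H s TN)) ((2 * H + 1) * (2 * (2 * H + 1)) ^ 2) with hXB
  have hle : ∀ t, t ∈ range (H + 1) → t ≤ H := fun t ht ↦ Nat.lt_succ_iff.mp (mem_range.mp ht)
  refine ⟨?_, ?_, ?_, ?_, rfl⟩
  · show (cubeScan H s R XA XB (H + 1) _).corr = _
    rw [cubeScan_eq]
    show 0 + cubeCorr H s R XA XB (H + 1) = _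
    rw [zero_add, cubeCorr_eq, sum_reflect3 H (fun t₁ t₂ t₃ ↦ corrC (wt t₁ * wt t₂ * wt t₃)
      (digitAt H s XA t₁ t₂ t₃) (digitAt H s XB t₁ t₂ t₃) (cls H R t₁ t₂ t₃))]
    refine Finset.sum_congr rfl fun t₃ h₃ ↦ Finset.sum_congr rfl fun t₂ h₂ ↦
      Finset.sum_congr rfl fun t₁ h₁ ↦ ?_
    rw [hXA, hXB, digitAt_A hS (hle _ h₁) (hle _ h₂) (hle _ h₃),
      digitAt_B hS (hle _ h₁) (hle _ h₂) (hle _ h₃)]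
  · show (cubeScan H s R XA XB (H + 1) _).pos = _
    rw [cubeScan_eq]
    show 0 + cubePos H s R XA XB (H + 1) = _
    rw [zero_add, cubePos_eq, sum_reflect3 H (fun t₁ t₂ t₃ ↦ posC (wt t₁ * wt t₂ * wt t₃)
      (digitAt H s XA t₁ t₂ t₃) (digitAt H s XB t₁ t₂ t₃) (cls H R t₁ t₂ t₃))]
    refine Finset.sum_congr rfl fun t₃ h₃ ↦ Finset.sum_congr rfl fun t₂ h₂ ↦
      Finset.sum_congr rfl fun t₁ h₁ ↦ ?_
    rw [hXA, hXB, digitAt_A hS (hle _ h₁) (hle _ h₂) (hle _ h₃),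
      digitAt_B hS (hle _ h₁) (hle _ h₂) (hle _ h₃)]
  · exact digitAt_A hS (Nat.zero_le _) (Nat.zero_le _) (Nat.zero_le _)
  · exact digitAt_B hS (Nat.zero_le _) (Nat.zero_le _) (Nat.zero_le _)

end ScanSpec

end CEKernel

end Literature.Barriers.AtomisticToContinuum
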